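import Literature.Geometry.Kaehler.StrataNbhdCechAssembly
import HarnessLib

/-!
# Descent to a neighbourhood of the configuration: the degree-one case

Topic `Literature/Geometry/Kaehler`. The degree-`1` companion of `StrataNbhdDescent` /
`CechDescentExactness` / `StrataNbhdCechAssembly` (which treat forms of degree `k + 2`): a smooth
closed `1`-form `x` on the compact manifold `M` whose pull-backs to all the strata `P_{(i)}` of a
strata system VANISH is exact on an open neighbourhood of `⋃_i emb (P_i)`
(`StrataMaps.exists_nbhd_restr_mem_localExactForms_degOne`). The Čech–de Rham descent has two
levels only: primitives `γ_{(i)}` near the `emb (P_i)` (T1), normalised by locally constant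
functions so that `emb_i^* γ_{(i)} = 0` (T2 in degree `0`), and then `γ_{(j)} - γ_{(i)}`, a
closed `0`-form near `emb (P_{ij})` with vanishing pull-back, vanishes near it (T1 in degree `0`),
so the `γ_{(i)}` glue (Bott–Tu (1982), Prop. 8.8 in total degree `1`). The level-`0` apparatus
(`T1Hyp₀`, `V1₀`, `g1₀`, `V2₀`, `ζ2₀`, `N₀`, `init`) is that of `StrataNbhdDescent`, run in form
degree `0` with the strata cochain `η = 0`. Everything is proved; no named facts (D-0026).

## References

* R. Bott, L. W. Tu, *Differential Forms in Algebraic Topology*, Springer GTM 82 (1982), §8,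
  Prop. 8.8. [BottTu1982Forms]
* G. E. Bredon, *Sheaf Theory*, 2nd ed., Springer GTM 170 (1997), §II.10. [Bredon1997]
-/

noncomputable section

open scoped Manifold ContDiff Topology
open Set Function Finset Literature.NumberTheory.Transcendental Literature.Geometry.Manifold
  Literature.Algebra.Homology
open _root_.Topology

universe u

namespace Literature.Geometry.Kaehler

set_option backward.isDefEq.respectTransparency false

/-! ### §1 The Čech assembly in total degree `1` -/

section Covered

variable {E : Type*} [NormedAddCommGroup E] [NormedSpace ℝ E] [FiniteDimensional ℝ E]
  {H : Type*} [TopologicalSpace H] {I : ModelWithCorners ℝ E H}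
  {M : Type*} [TopologicalSpace M] [ChartedSpace H M] [IsManifold I ∞ M] [T2Space M]
  [SigmaCompactSpace M]
  {F : Type*} [NormedAddCommGroup F] [NormedSpace ℝ F]
  {ι : Type*} [Fintype ι]

/-- **Exactness of a `1`-form from Čech–de Rham descent data** (Bott–Tu (1982), Prop. 8.8 in
total degree `1`): if `d γ_{(i)} = x` on `u_i` and `γ_{(j)} = γ_{(i)}` on `u_i ∩ u_j` for
functions `γ_{(i)}` smooth on the `u_i`, then the smooth `1`-form `x` is exact.
[cite: BottTu1982Forms, §8, Prop. 8.8] -/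
theorem mem_localExactForms_univ_of_cechDescent_degOne {u : ι → Set M} (hu : ∀ i, IsOpen (u i))
    (hcov : ∀ y, ∃ i, y ∈ u i) {x : MForm I M F 1} (hx : IsSmoothForm x)
    (γ : (Fin 1 → ι) → MForm I M F 0)
    (hγs : ∀ J, ∀ y ∈ cechSet u J, (γ J).SmoothAt y)
    (h0 : ∀ J, ∀ y ∈ cechSet u J, mextDeriv (γ J) y = x y)
    (hL : ∀ (J : Fin 2 → ι), ∀ y ∈ cechSet u J,
      ∑ j : Fin 2, (-1 : ℝ) ^ (j : ℕ) • γ (J ∘ Fin.succAbove j) y = 0) :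
    x ∈ localExactForms I F (isOpen_univ : IsOpen (univ : Set M)) 1 := by
  classical
  obtain ⟨ρ, hρ⟩ := SmoothPartitionOfUnity.exists_isSubordinate I isClosed_univ u hu
    (fun y _ ↦ mem_iUnion.2 (hcov y))
  have hK : (cechDeRham I F hu).RowExact := cechDeRham_rowExact hu ρ hρ
  have hEx : (cechDeRhamRow I F hu).Exact := cechDeRhamRow_exact hu ρ hρ hcov
  have hwmem : ∀ J : Fin 1 → ι, (γ J).restr (cechSet u J) ∈ smoothFormsOn I F (cechSet u J) 0 :=
    fun J ↦ ⟨fun y hy ↦ (MForm.smoothAt_restr_iff (isOpen_cechSet hu J) _ hy).2 (hγs J y hy),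
      fun y hy ↦ MForm.restr_apply_of_notMem _ hy⟩
  let w : ∀ p q, CechForms I F u p q := fun p q ↦ match p, q with
    | 0, 0 => fun J ↦ ⟨_, hwmem J⟩
    | _ + 1, _ => 0
    | 0, _ + 1 => 0
  have hw00 : ∀ J, (w 0 0 J : MForm I M F 0) = (γ J).restr (cechSet u J) := fun J ↦ rfl
  have hw : w ∈ ADoubleComplex.Tn ℝ 0 := by
    intro p q h
    cases p with
    | zero => cases q with
      | zero => exact absurd rfl h
      | succ q => rfl
    | succ p => rfl
  let a : smoothFormsOn I F (univ : Set M) 1 :=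
    ⟨x, by rw [smoothFormsOn_univ]; exact (mem_smoothForms_iff x).2 hx⟩
  have hD : (cechDeRham I F hu).totalD w =
      ADoubleComplex.single 0 1 ((cechDeRhamRow I F hu).ε 1 a) := by
    funext p q
    cases p with
    | zero =>
      cases q with
      | zero =>
        rw [ADoubleComplex.totalD_apply_zero_zero, ADoubleComplex.single_apply_of_ne_snd (by omega)]
      | succ q =>
        rw [ADoubleComplex.totalD_apply_zero_succ]
        cases q with
        | zero =>
          rw [ADoubleComplex.single_apply_same]
          funext J
          apply Subtype.ext
          change ((cechd I F hu 0 0 (w 0 0)) J : MForm I M F 1) = _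
          rw [cechd_apply, pow_zero, one_smul, coe_localD, coe_cechDeRhamRow_ε, hw00 J]
          funext y
          by_cases hy : y ∈ cechSet u J
          · rw [MForm.restr_apply_of_mem _ hy, MForm.restr_apply_of_mem _ hy,
              mextDeriv_restr_apply (isOpen_cechSet hu J) _ hy, h0 J y hy]
          · rw [MForm.restr_apply_of_notMem _ hy, MForm.restr_apply_of_notMem _ hy]
        | succ q =>
          change (cechDeRham I F hu).d 0 (q + 1) 0 = _
          rw [map_zero, ADoubleComplex.single_apply_of_ne_snd (by omega)]
    | succ p =>
      cases q with
      | zero =>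
        rw [ADoubleComplex.totalD_apply_succ_zero, ADoubleComplex.single_apply_of_ne_fst (by omega)]
        cases p with
        | zero =>
          funext J
          apply Subtype.ext
          change ((cechδ I F hu 0 0 (w 0 0)) J : MForm I M F 0) = 0
          funext y
          by_cases hy : y ∈ cechSet u J
          · rw [coe_cechδ_apply_apply_of_mem hu _ hy]
            have : ∀ j : Fin 2, ((w 0 0 (J ∘ Fin.succAbove j) : MForm I M F 0)) y =
                γ (J ∘ Fin.succAbove j) y := fun j ↦ by
              rw [hw00, MForm.restr_apply_of_mem _ (cechSet_subset_comp u J _ hy)]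
            simp_rw [this]
            rw [hL J y hy]
            rfl
          · exact (cechδ I F hu 0 0 (w 0 0) J).2.2 y hy
        | succ p =>
          change (cechDeRham I F hu).δ (p + 1) 0 0 = 0
          rw [map_zero]
      | succ q =>
        rw [ADoubleComplex.totalD_apply_succ_succ, ADoubleComplex.single_apply_of_ne_fst (by omega)]
        have h1 : w p (q + 1) = 0 := by cases p <;> rfl
        have h2 : w (p + 1) q = 0 := rfl
        rw [h1, h2, map_zero, map_zero, add_zero]
  obtain ⟨a', ha'⟩ := (cechDeRhamRow I F hu).exists_dA_eq_of_colLE hK hEx 0 0 a w hw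
    (ADoubleComplex.colLE_of_mem_Tn hw) hD
  exact (mem_localExactForms_succ_iff isOpen_univ).2 ⟨a', congrArg Subtype.val ha'⟩

end Covered

/-! ### §2 On the union of a finite family of opens of an ambient manifold -/

section Ambient

variable {E : Type u} [NormedAddCommGroup E] [NormedSpace ℝ E] [FiniteDimensional ℝ E]
  {M : Type u} [TopologicalSpace M] [ChartedSpace E M] [IsManifold 𝓘(ℝ, E) ∞ M] [T2Space M]
  [SecondCountableTopology M] [LocallyCompactSpace M]
  {F : Type*} [NormedAddCommGroup F] [NormedSpace ℝ F]
  {ι : Type*} [Fintype ι]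

/-- **Exactness of a `1`-form on `⋃ i, U i` from Čech–de Rham descent data** along a finite
family of opens of a manifold (Bott–Tu (1982), Prop. 8.8 on the open submanifold `⋃ i, U i`,
primitive extended by zero). [cite: BottTu1982Forms, §8, Prop. 8.8] -/
theorem restr_mem_localExactForms_of_cechDescent_degOne {U : ι → Set M} (hU : ∀ i, IsOpen (U i))
    {x : MForm 𝓘(ℝ, E) M F 1} (hx : ∀ y ∈ ⋃ i, U i, x.SmoothAt y)
    (γ : (Fin 1 → ι) → MForm 𝓘(ℝ, E) M F 0)
    (hγs : ∀ J, ∀ y ∈ cechSet U J, (γ J).SmoothAt y)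
    (h0 : ∀ J, ∀ y ∈ cechSet U J, mextDeriv (γ J) y = x y)
    (hL : ∀ (J : Fin 2 → ι), ∀ y ∈ cechSet U J,
      ∑ j : Fin 2, (-1 : ℝ) ^ (j : ℕ) • γ (J ∘ Fin.succAbove j) y = 0) :
    x.restr (⋃ i, U i) ∈ localExactForms 𝓘(ℝ, E) F (isOpen_iUnion hU) 1 := by
  set Ω : TopologicalSpace.Opens M := ⟨⋃ i, U i, isOpen_iUnion hU⟩ with hΩdef
  have hΩ : ((Ω : Set M)) = ⋃ i, U i := rfl
  rcases isEmpty_or_nonempty Ω with hΩe | ⟨⟨w₀⟩⟩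
  · have he : (⋃ i, U i) = ∅ := by
      rw [← hΩ]
      exact Set.isEmpty_coe_sort.1 hΩe
    have : x.restr (⋃ i, U i) = 0 := by
      funext m
      exact MForm.restr_apply_of_notMem _ (by rw [he]; exact notMem_empty m)
    rw [this]
    exact zero_mem _
  haveI : LocallyCompactSpace Ω := (isOpen_iUnion hU).locallyCompactSpace
  let u : ι → Set Ω := fun i ↦ Subtype.val ⁻¹' U i
  have hu : ∀ i, IsOpen (u i) := fun i ↦ (hU i).preimage continuous_subtype_val
  have hcov : ∀ y : Ω, ∃ i, y ∈ u i := fun y ↦ by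
    obtain ⟨i, hi⟩ := mem_iUnion.1 (show (y : M) ∈ ⋃ i, U i from y.2)
    exact ⟨i, hi⟩
  have hcs : ∀ {n : ℕ} (J : Fin n → ι) (y : Ω), y ∈ cechSet u J ↔ (y : M) ∈ cechSet U J := by
    intro n J y
    simp only [mem_cechSet_iff, u, Set.mem_preimage]
  set x' := x.pullback 𝓘(ℝ, E) (Subtype.val : Ω → M) with hx'def
  have hx' : IsSmoothForm x' :=
    (isSmoothForm_iff_smoothAt _).2 fun y ↦ MForm.SmoothAt.pullback_subtypeVal (hx y y.2)
  let γ' : (Fin 1 → ι) → MForm 𝓘(ℝ, E) Ω F 0 := fun J ↦ (γ J).pullback 𝓘(ℝ, E) Subtype.val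
  have key := mem_localExactForms_univ_of_cechDescent_degOne (I := 𝓘(ℝ, E)) hu hcov hx' γ' ?_ ?_ ?_
  · obtain ⟨a', ha'⟩ := (mem_localExactForms_succ_iff isOpen_univ).1 key
    let β : MForm 𝓘(ℝ, E) M F 0 := MForm.extendOpensReal (a' : MForm 𝓘(ℝ, E) Ω F 0) w₀
    have hβ : β ∈ smoothFormsOn 𝓘(ℝ, E) F (Ω : Set M) 0 :=
      ⟨fun m hm ↦ MForm.smoothAt_extendOpensReal hm (a'.2.1 _ (mem_univ _)),
        fun m hm ↦ MForm.extendOpensReal_apply_of_notMem _ hm⟩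
    refine (mem_localExactForms_succ_iff _).2 ⟨⟨β, hβ⟩, ?_⟩
    rw [coe_localD]
    funext m
    by_cases hm : m ∈ ⋃ i, U i
    · rw [MForm.restr_apply_of_mem _ hm, MForm.restr_apply_of_mem _ hm]
      have hsm : β.SmoothAt m := hβ.1 m hm
      have e2 : mextDeriv (a' : MForm 𝓘(ℝ, E) Ω F 0) = x' := by
        rw [← MForm.restr_univ (mextDeriv _), ← coe_localD isOpen_univ a', ha']
      ext v
      have e1 := mextDeriv_pullback_subtypeVal_apply (U := Ω) (x := ⟨m, hm⟩) hsm v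
      rw [MForm.pullback_subtypeVal_extendOpensReal, e2] at e1
      rw [← e1]
      exact MForm.pullback_subtypeVal_apply x ⟨m, hm⟩ v
    · rw [MForm.restr_apply_of_notMem _ hm, MForm.restr_apply_of_notMem _ hm]
  · intro J y hy
    exact MForm.SmoothAt.pullback_subtypeVal (hγs J y ((hcs J y).1 hy))
  · intro J y hy
    have hyM := (hcs J y).1 hy
    ext v
    rw [mextDeriv_pullback_subtypeVal_apply (hγs J _ hyM) v, MForm.pullback_subtypeVal_apply,
      h0 J _ hyM]
  · intro J y hy
    have hyM := (hcs J y).1 hy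
    ext v
    have h1 := congrArg (fun φ ↦ φ v) (hL J _ hyM)
    simp only [ContinuousAlternatingMap.sum_apply, ContinuousAlternatingMap.smul_apply,
      ContinuousAlternatingMap.coe_zero, Pi.zero_apply] at h1 ⊢
    simp only [γ', MForm.pullback_subtypeVal_apply]
    exact h1

end Ambient

/-! ### §3 The two-level descent for a strata system and the assembly -/

section Strata

variable {ι : Type} [DecidableEq ι]
  {EM : Type u} [NormedAddCommGroup EM] [NormedSpace ℂ EM] [FiniteDimensional ℂ EM]
  {M : Type u} [TopologicalSpace M] [ChartedSpace EM M] [IsManifold 𝓘(ℝ, EM) ∞ M]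
  [CompactSpace M] [T2Space M] [SecondCountableTopology M]
  {EP : Finset ι → Type u} [∀ I, NormedAddCommGroup (EP I)] [∀ I, NormedSpace ℂ (EP I)]
  [∀ I, FiniteDimensional ℂ (EP I)]
  {P : Finset ι → Type u} [∀ I, TopologicalSpace (P I)] [∀ I, ChartedSpace (EP I) (P I)]
  [∀ I, IsManifold 𝓘(ℝ, EP I) ∞ (P I)] [∀ I, CompactSpace (P I)] [∀ I, T2Space (P I)]
  [∀ I, SecondCountableTopology (P I)]

namespace StrataMaps

variable {T : StrataMaps (EM := EM) M EP P} {x : (q : ℕ) → MForm 𝓘(ℝ, EM) M ℂ q}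
  (hTe : ∀ I, IsEmbedding (T.emb I)) (hx : x 1 ∈ closedSmoothForms 𝓘(ℝ, EM) M ℂ 1)
  (hx0 : ∀ J : Fin 1 → ι, T.sres (x 1) J = 0)
include hTe hx hx0

omit [FiniteDimensional ℂ EM] [IsManifold 𝓘(ℝ, EM) ∞ M] [CompactSpace M] [T2Space M]
  [SecondCountableTopology M] [∀ I, FiniteDimensional ℂ (EP I)] [∀ I, IsManifold 𝓘(ℝ, EP I) ∞ (P I)]
  [∀ I, CompactSpace (P I)] [∀ I, T2Space (P I)] [∀ I, SecondCountableTopology (P I)] in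
/-- T1 applies at level `0`, form degree `0`, for a closed `1`-form with vanishing pull-backs and
the strata cochain `η = 0`. [folklore] -/
theorem t1Hyp₀_degOne (J : Fin 1 → ι) : T.T1Hyp₀ 0 x 0 J := by
  refine ⟨hTe _, mem_localClosedForms_univ_of_mem_closedSmoothForms hx, ?_, ?_⟩
  · exact isSmoothForm_zero
  · change T.sres (x 1) J = mextDeriv 0
    rw [hx0 J, mextDeriv_zero]

/-- `emb^*(d g_{(i)}) = 0` for the level-`0` primitive. [folklore] -/
theorem srho_mextDeriv_g1₀_degOne (J : Fin 1 → ι) : T.srho (mextDeriv (T.g1₀ 0 x 0 J)) J = 0 := by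
  have h1 := t1Hyp₀_degOne hTe hx hx0 J
  obtain ⟨-, hVf, -, hdg⟩ := T.V1₀_spec 0 x h1
  rw [srho, ← MForm.pullback_restr_of_forall_mem hVf, hdg, MForm.pullback_restr_of_forall_mem hVf]
  exact hx0 J

/-- T2 (degree `0`) applies at level `0`. [folklore] -/
theorem t2Hyp₀_degOne (J : Fin 1 → ι) : T.T2Hyp₀ 0 x 0 J := by
  have h1 := t1Hyp₀_degOne hTe hx hx0 J
  obtain ⟨hV, hVf, hg, -⟩ := T.V1₀_spec 0 x h1
  have hA : IsSmoothForm (T.srho (T.g1₀ 0 x 0 J) J) :=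
    isSmoothForm_pullback_of_mem_smoothFormsOn hg (T.contMDiff_emb _) hVf
  refine ⟨hTe _, hV, hVf, ?_, ?_⟩
  · change IsSmoothForm (T.srho (T.g1₀ 0 x 0 J) J - 0)
    rw [sub_zero]; exact hA
  · change IsClosedForm (T.srho (T.g1₀ 0 x 0 J) J - 0)
    rw [sub_zero, IsClosedForm, srho, mextDeriv_pullback_of_mem_smoothFormsOn hg (T.contMDiff_emb _) hVf,
      ← srho, srho_mextDeriv_g1₀_degOne hTe hx hx0 J]

/-- **`d γ_{(i)} = x` at the points of `N_0 (i)`** (degree one). [cite: BottTu1982Forms, Prop. 8.8] -/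
theorem mextDeriv_init_γ_apply_degOne (J : Fin 1 → ι) {y : M} (hy : y ∈ T.N₀ 0 0 x J) :
    mextDeriv ((T.init 0 0 x).γ 0 J) y = x 1 y := by
  have h1 := t1Hyp₀_degOne hTe hx hx0 J
  obtain ⟨-, -, -, hdg⟩ := T.V1₀_spec 0 x h1
  have hN : IsOpen (T.N₀ 0 0 x J) := T.isOpen_N₀ 0 0 x J
  have hy2 : y ∈ T.V2₀ 0 x 0 J := T.N₀_subset_V2₀ 0 0 x (Nat.zero_le _) J hy
  have hy1 : y ∈ T.V1₀ 0 x 0 J := T.V2₀_subset_V1₀ 0 x _ J hy2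
  change mextDeriv ((T.g1₀ 0 x 0 J - T.ζ2₀ 0 x 0 J).restr (T.N₀ 0 0 x J)) y = _
  rw [mextDeriv_restr_apply hN _ hy,
    mextDeriv_sub_apply (T.g1₀_smoothAt 0 x _ J hy1) (T.ζ2₀_smoothAt 0 x _ J hy2).1,
    (T.ζ2₀_smoothAt 0 x _ J hy2).2, sub_zero]
  have := congrFun hdg y
  rwa [MForm.restr_apply_of_mem _ hy1, MForm.restr_apply_of_mem _ hy1] at this

/-- **`emb_i^* γ_{(i)} = 0`** after the degree-`0` normalisation. [cite: BottTu1982Forms, Prop. 8.8] -/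
theorem srho_init_γ_degOne (J : Fin 1 → ι) : T.srho ((T.init 0 0 x).γ 0 J) J = 0 := by
  have h2 := t2Hyp₀_degOne hTe hx hx0 J
  obtain ⟨-, -, -, -, hζ⟩ := T.V2₀_spec_zero 0 x h2
  change T.srho ((T.g1₀ 0 x 0 J - T.ζ2₀ 0 x 0 J).restr (T.N₀ 0 0 x J)) J = 0
  rw [srho, MForm.pullback_restr_of_forall_mem (T.emb_mem_N₀ 0 0 x J), MForm.pullback_sub',
    ← srho, ← srho, hζ, lam2₀]
  change _ - (_ - 0) = 0
  rw [sub_zero, sub_self]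

omit hTe hx hx0 in
/-- `γ_{(i)}` is smooth on `N_0 (i)`. [folklore] -/
theorem init_γ_mem_smoothFormsOn_degOne (J : Fin 1 → ι) :
    (T.init 0 0 x).γ 0 J ∈ smoothFormsOn 𝓘(ℝ, EM) ℂ (T.N₀ 0 0 x J) 0 := by
  refine ⟨fun y hy ↦ (MForm.smoothAt_restr_iff (T.isOpen_N₀ 0 0 x J) _ hy).2 ?_,
    fun y hy ↦ MForm.restr_apply_of_notMem _ hy⟩
  have hy2 : y ∈ T.V2₀ 0 x 0 J := T.N₀_subset_V2₀ 0 0 x (Nat.zero_le _) J hy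
  exact (T.g1₀_smoothAt 0 x 0 J (T.V2₀_subset_V1₀ 0 x 0 J hy2)).sub (T.ζ2₀_smoothAt 0 x 0 J hy2).1

/-- **The last level in degree one**: `γ_{(j)} - γ_{(i)}`, a closed `0`-form near `emb (P_{ij})`
with vanishing pull-back, vanishes on a smaller neighbourhood. [cite: BottTu1982Forms, Prop. 8.8]
[cite: Bredon1997, II.10.6] -/
theorem exists_last_degOne (J : Fin 2 → ι) :
    ∃ V : Set M, IsOpen V ∧ V ⊆ (T.init 0 0 x).W J ∧
      (∀ y, T.emb (tupleSupport J) y ∈ V) ∧ cdelta V ((T.init 0 0 x).γ 0) J = 0 := by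
  set st := T.init 0 0 x
  have hNo : ∀ J', IsOpen (st.N J') := fun J' ↦ T.isOpen_N₀ 0 0 x J'
  have hNe : ∀ J' y, T.emb (tupleSupport J') y ∈ st.N J' := fun J' y ↦ T.emb_mem_N₀ 0 0 x J' y
  have hW : IsOpen (st.W J) := isOpen_iInter_of_finite fun j ↦ hNo _
  have hWf : ∀ y, T.emb (tupleSupport J) y ∈ st.W J := T.emb_mem_W hNe J
  have hsm : ∀ j, st.γ 0 (J ∘ Fin.succAbove j) ∈ smoothFormsOn 𝓘(ℝ, EM) ℂ (st.N (J ∘ Fin.succAbove j)) 0 :=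
    fun j ↦ init_γ_mem_smoothFormsOn_degOne _
  have hc : cdelta (st.W J) (st.γ 0) J ∈ localClosedForms 𝓘(ℝ, EM) ℂ 0 (st.W J) := by
    refine ⟨cdelta_mem_smoothFormsOn hW J (fun j ↦ iInter_subset _ j) hsm, fun y hy ↦ ?_⟩
    have hyi : ∀ i, y ∈ st.N (J ∘ Fin.succAbove i) := fun i ↦ mem_iInter.1 hy i
    rw [mextDeriv_cdelta_apply hW _ J hy fun j ↦ (hsm j).1 y (hyi j), Fin.sum_univ_two]
    simp only [Fin.val_zero, pow_zero, one_smul, Fin.val_one, pow_one, neg_one_smul]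
    rw [mextDeriv_init_γ_apply_degOne hTe hx hx0 _ (hyi 0),
      mextDeriv_init_γ_apply_degOne hTe hx hx0 _ (hyi 1), add_neg_cancel]
  have hρ : T.srho (cdelta (st.W J) (st.γ 0) J) J = 0 := by
    rw [T.srho_cdelta _ J hWf]
    have : (fun J' : Fin 1 → ι ↦ T.srho (st.γ 0 J') J') = 0 := by
      funext J'
      exact srho_init_γ_degOne hTe hx hx0 J'
    rw [this, delta_zero]
    rfl
  obtain ⟨V, hV, hVW, hfV, h0⟩ :=
    exists_nhd_restr_eq_zero_of_pullback_eq_zero_complex (T.contMDiff_emb _) (hTe _) hW hWf hc hρ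
  exact ⟨V, hV, hVW, fun y ↦ hfV (mem_range_self y), by rw [← cdelta_restr hVW, h0]⟩

omit hx hx0 in
/-- **A closed `1`-form with vanishing pull-backs to the strata is exact near the configuration**
(Bott–Tu (1982), Prop. 8.8 in total degree `1`, with the tautness of the compact strata).
[cite: BottTu1982Forms, §8, Prop. 8.8] [cite: Bredon1997, II.10.6] -/
theorem exists_nbhd_restr_mem_localExactForms_degOne [Fintype ι]
    (hTr : ∀ {n : ℕ} (J : Fin (n + 1) → ι),
      (⋂ l, Set.range (T.emb {J l})) ⊆ Set.range (T.emb (tupleSupport J)))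
    {ξ : MForm 𝓘(ℝ, EM) M ℂ 1} (hξ : ξ ∈ closedSmoothForms 𝓘(ℝ, EM) M ℂ 1)
    (hξ0 : ∀ J : Fin 1 → ι, T.sres ξ J = 0) :
    ∃ (Ω : Set M) (hΩ : IsOpen Ω), (⋃ i, Set.range (T.emb {i})) ⊆ Ω ∧
      ξ.restr Ω ∈ localExactForms 𝓘(ℝ, EM) ℂ hΩ 1 := by
  classical
  haveI : FiniteDimensional ℝ EM := FiniteDimensional.complexToReal EM
  letI : MetricSpace M := TopologicalSpace.metrizableSpaceMetric M
  let x : (q : ℕ) → MForm 𝓘(ℝ, EM) M ℂ q := fun q ↦ if h : q = 1 then h ▸ ξ else 0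
  have hxq : x 1 = ξ := by simp [x]
  have hx : x 1 ∈ closedSmoothForms 𝓘(ℝ, EM) M ℂ 1 := by rw [hxq]; exact hξ
  have hx0 : ∀ J : Fin 1 → ι, T.sres (x 1) J = 0 := by intro J; rw [hxq]; exact hξ0 J
  set st := T.init 0 0 x
  have hNo : ∀ J', IsOpen (st.N J') := fun J' ↦ T.isOpen_N₀ 0 0 x J'
  have hNe : ∀ J' y, T.emb (tupleSupport J') y ∈ st.N J' := fun J' y ↦ T.emb_mem_N₀ 0 0 x J' y
  choose V hVo hVW hVe hVc using exists_last_degOne (T := T) hTe hx hx0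
  -- the compact images and the requirements on `ε`
  set K : ι → Set M := fun i ↦ Set.range (T.emb {i}) with hK
  have hKc : ∀ i, IsCompact (K i) := fun i ↦ isCompact_range (T.contMDiff_emb _).continuous
  have hKJ : ∀ {n : ℕ} (J : Fin (n + 1) → ι) (S : Set M),
      (∀ y, T.emb (tupleSupport J) y ∈ S) → (⋂ l, K (J l)) ⊆ S := by
    intro n J S hS
    refine (hTr J).trans ?_
    rintro _ ⟨y, rfl⟩
    exact hS y
  let C : Type := (Fin 1 → ι) ⊕ (Fin 2 → ι)
  let Q : C → ℝ → Prop := fun c ε ↦ match c with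
    | Sum.inl J => (⋂ l, Metric.thickening ε (K (J l))) ⊆ st.N J
    | Sum.inr J => (⋂ l, Metric.thickening ε (K (J l))) ⊆ V J
  have hQmono : ∀ c ε ε', 0 < ε' → ε' ≤ ε → Q c ε → Q c ε' := by
    rintro (J | J) ε ε' - hle hQ
    · exact (Set.iInter_mono fun l ↦ Metric.thickening_mono hle _).trans hQ
    · exact (Set.iInter_mono fun l ↦ Metric.thickening_mono hle _).trans hQ
  have hQex : ∀ c, ∃ ε > (0 : ℝ), Q c ε := by
    rintro (J | J)
    · exact exists_pos_iInter_thickening_subset _ (fun l ↦ hKc _) (hNo J) (hKJ J _ (hNe J))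
    · exact exists_pos_iInter_thickening_subset _ (fun l ↦ hKc _) (hVo J) (hKJ J _ (hVe J))
  obtain ⟨ε, hε, hQε⟩ := exists_pos_forall_of_finite Q hQmono hQex
  let U : ι → Set M := fun i ↦ Metric.thickening ε (K i)
  have hU : ∀ i, IsOpen (U i) := fun i ↦ Metric.isOpen_thickening
  have hUN : ∀ J : Fin 1 → ι, cechSet U J ⊆ st.N J := fun J ↦ hQε (Sum.inl J)
  have hUV : ∀ J : Fin 2 → ι, cechSet U J ⊆ V J := fun J ↦ hQε (Sum.inr J)
  refine ⟨⋃ i, U i, isOpen_iUnion hU,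
    Set.iUnion_mono fun i ↦ Metric.self_subset_thickening hε _, ?_⟩
  have hsm : ∀ (r : ℝ) {b : ℕ} (φ : EM [⋀^Fin b]→L[ℝ] ℂ), r • φ = (r : ℂ) • φ :=
    fun r b φ ↦ real_smul_eq_complex_smul_calt r φ
  refine restr_mem_localExactForms_of_cechDescent_degOne hU
    (fun y _ ↦ (isSmoothForm_iff_smoothAt _).1 hξ.1 y) (fun J ↦ st.γ 0 J) ?_ ?_ ?_
  · intro J y hy
    exact (init_γ_mem_smoothFormsOn_degOne J).1 y (hUN J hy)
  · intro J y hy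
    rw [mextDeriv_init_γ_apply_degOne hTe hx hx0 J (hUN J hy), hxq]
  · intro J y hy
    have h1 := congrFun (hVc J) y
    rw [Pi.zero_apply, cdelta_apply_of_mem _ J (hUV J hy)] at h1
    simp only [hsm, Complex.ofReal_pow, Complex.ofReal_neg, Complex.ofReal_one]
    exact h1

end StrataMaps

end Strata

end Literature.Geometry.Kaehler

end
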